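import Mathlib
import Literature.AlgebraicGeometry.Resolution.WeightedQuasiRegularGeneral
import HarnessLib

/-!
# Weighted order ideals `F^{(w)}_ρ = (c^e : ⟨w, e⟩ ≥ ρ)` for an ARBITRARY finite family of parameters `c : σ → R`

Topic: `Literature/AlgebraicGeometry/Resolution`. Dimension-general form of `WeightedOrderIdeals.lean` (weights `(1, d, d)` on three
parameters) and of `WeightedQuasiRegularGeneral.lean` (`weightedIdealW`: arbitrary positive integer weights on `c : Fin 3 → R`) — the
first brick of the generalisation `Fin 3 → Fin (r + 2)` of the tree's expansion-free rendering of Hironaka's characteristic polyhedra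
(`WeightedInitialTerms`, `Resolution/PolygonInvariants`, `PointBlowupPolygonLaws`, …, `AxialUnitChainLaw`) that the key theorem 6.40 of
Cossart–Jannsen–Saito for ARBITRARY embedding dimension needs (`r = edim − 2` y-variables of equal weight; memo
`run/shared/lean/pub/res-hironaka/L/res-L1-w42-stub-3/KEYCLAIM-PORT-PLAN.md` §4).

Source of the notion: V. Cossart, U. Jannsen, S. Saito, *Desingularization: Invariants and Strategy*, LNM **2270** (2020)
[`CossartJannsenSaito2020`], Ch. 7 Setup A and **Def. 7.2 (1)** (held text chunk p0109): for a regular local ring `R` with regular system of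
parameters `(y, u) = (y₁, …, y_r, u₁, …, u_e)` and a non-zero semi-positive linear form `L(A) = Σ cᵢ aᵢ` on `ℝ^e`, «the `L`-valuation of `f`
with respect to `(y, u)`: `v_L(f) := min{|B| + L(A) | C_{A,B} ≠ 0}`» read on a presentation `f = Σ C_{A,B} y^B u^A` ((7.3)/(7.5)); and
H. Hironaka, *Characteristic polyhedra of singularities*, J. Math. Kyoto Univ. 7 (1967), §1 [`Hironaka1967`]. EXPANSION-FREE RENDERING (as in
the two tree files): for INTEGER weights `w : σ → ℕ` on the whole family `c : σ → R` (the y-block carrying a common weight), the ideal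
`F^{(w)}_ρ` generated by the monomials `c^e = ∏ c_i^{e_i}` of weight `⟨w, e⟩ = Σ w_i e_i ≥ ρ`; then «`v_w(f) ≥ ρ`» IS `f ∈ F^{(w)}_ρ`
(presentation-independent by construction; the link to Def. 7.2's `min` over a presentation is weighted quasi-regularity, next file).

## Content (namespace `Literature.AlgebraicGeometry.Resolution`; `σ` any finite index type)

* `cmonom c e = ∏ c_i^{e_i}` (Mathlib's `Finsupp.prod`, so that `eval c (monomial e a) = a · cmonom c e`), `cmonom_add`, `cmonom_single`;
* `weightedOrderIdeal c w ρ = F^{(w)}_ρ`; `cmonom_mem_weightedOrderIdeal`, `weightedOrderIdeal_zero` (`F_0 = R`), `weightedOrderIdeal_antitone`,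
  `weightedOrderIdeal_mul_le` (`F_ρ F_σ ⊆ F_{ρ+σ}`: the `F_ρ` form a multiplicative filtration), `weightedOrderIdeal_pow_le`,
  `maximalIdeal_mul_weightedOrderIdeal_le` / `pow_maximalIdeal_le_weightedOrderIdeal` (`𝔪^ρ ⊆ F_ρ` for positive weights, `(c) = 𝔪`),
  `weightedOrderIdeal_le_pow` (`F^{(w)}_{Wρ} ⊆ I^ρ` when all `w_i ≤ W`, `W > 0`, `c_i ∈ I`), `weightedOrderIdeal_one_eq_pow` (`w ≡ 1 ⇒ F_ρ = 𝔪^ρ`),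
  `mem_weightedOrderIdeal_iff_exists_mvPolynomial` (`F_ρ = {P(c) : every monomial of P has weight ≥ ρ}`);
* `weightedIdealW_eq_weightedOrderIdeal` — for `σ = Fin 3` this IS the tree's `weightedIdealW` (compatibility with the whole `Fin 3`
  development).

No named facts; no instance, notation or attribute. Everything proved. Nothing about schemes.
-/

noncomputable section

open IsLocalRing MvPolynomial

namespace Literature.AlgebraicGeometry.Resolution

universe u v

variable {R : Type u} [CommRing R] {σ : Type v}

/-! ## Monomials in a family of elements -/

/-- **The monomial `c^e = ∏ᵢ cᵢ^{eᵢ}`** in a family `c : σ → R` (Mathlib's `Finsupp.prod`, the shape of `MvPolynomial.eval_monomial`).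
[cite: CossartJannsenSaito2020, (7.3)] -/
def cmonom (c : σ → R) (e : σ →₀ ℕ) : R := e.prod fun i k => c i ^ k

/-- `eval c (monomial e a) = a · c^e`. [cite: CossartJannsenSaito2020, (7.3)] -/
theorem eval_monomial_eq_cmonom (c : σ → R) (e : σ →₀ ℕ) (a : R) :
    eval c (monomial e a) = a * cmonom c e :=
  eval_monomial

/-- `c^{e + e'} = c^e · c^{e'}`. [cite: CossartJannsenSaito2020, (7.3)] -/
theorem cmonom_add (c : σ → R) (e e' : σ →₀ ℕ) : cmonom c (e + e') = cmonom c e * cmonom c e' :=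
  Finsupp.prod_add_index' (fun i => pow_zero (c i)) (fun i m n => pow_add (c i) m n)

/-- `c^{δ_i} = c_i`. [cite: CossartJannsenSaito2020, (7.3)] -/
theorem cmonom_single (c : σ → R) (i : σ) : cmonom c (Finsupp.single i 1) = c i := by
  simp [cmonom, Finsupp.prod_single_index]

/-- `c^{n δ_i} = c_i ^ n`. [cite: CossartJannsenSaito2020, (7.3)] -/
theorem cmonom_single_pow (c : σ → R) (i : σ) (n : ℕ) : cmonom c (Finsupp.single i n) = c i ^ n := by
  simp [cmonom, Finsupp.prod_single_index]

/-- `c^0 = 1`. [cite: CossartJannsenSaito2020, (7.3)] -/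
theorem cmonom_zero (c : σ → R) : cmonom c 0 = 1 := by
  rw [cmonom, Finsupp.prod_zero_index]

/-- With finitely many indices, `c^e = ∏_{i} c_i^{e_i}` over all `i`. [cite: CossartJannsenSaito2020, (7.3)] -/
theorem cmonom_eq_prod [Fintype σ] (c : σ → R) (e : σ →₀ ℕ) : cmonom c e = ∏ i, c i ^ e i :=
  Finsupp.prod_fintype _ _ fun i => pow_zero (c i)

/-! ## The weighted order ideals -/

/-- **The weighted order ideal `F^{(w)}_ρ = (c^e : ⟨w, e⟩ ≥ ρ)`** of a family `c : σ → R` for integer weights `w : σ → ℕ`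
(`⟨w, e⟩ = Finsupp.weight w e = Σ w_i e_i`): the expansion-free carrier of «`v_L(f) ≥ ρ`» for CJS's `L`-valuation (Def. 7.2 (1); the
y-variables of Setup A being the indices of weight `w₀`, a positive linear form `L` on the `u`-block). Dimension-general form of the tree's
`weightedIdealW` (`σ = Fin 3`). [cite: CossartJannsenSaito2020, Def. 7.2 (1)] -/
def weightedOrderIdeal (c : σ → R) (w : σ → ℕ) (ρ : ℕ) : Ideal R :=
  Ideal.span {m | ∃ e : σ →₀ ℕ, ρ ≤ Finsupp.weight w e ∧ m = cmonom c e}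

/-- Monomials of weight `≥ ρ` lie in `F_ρ`. [cite: CossartJannsenSaito2020, Def. 7.2 (1)] -/
theorem cmonom_mem_weightedOrderIdeal (c : σ → R) (w : σ → ℕ) {ρ : ℕ} {e : σ →₀ ℕ}
    (h : ρ ≤ Finsupp.weight w e) : cmonom c e ∈ weightedOrderIdeal c w ρ :=
  Ideal.subset_span ⟨e, h, rfl⟩

/-- `F_0 = R`. [cite: CossartJannsenSaito2020, Def. 7.2 (1)] -/
theorem weightedOrderIdeal_zero (c : σ → R) (w : σ → ℕ) : weightedOrderIdeal c w 0 = ⊤ := by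
  rw [Ideal.eq_top_iff_one, ← cmonom_zero c]
  exact cmonom_mem_weightedOrderIdeal c w (Nat.zero_le _)

/-- `F_ρ` decreases with `ρ`. [cite: CossartJannsenSaito2020, Def. 7.2 (1)] -/
theorem weightedOrderIdeal_antitone (c : σ → R) (w : σ → ℕ) {ρ ρ' : ℕ} (h : ρ ≤ ρ') :
    weightedOrderIdeal c w ρ' ≤ weightedOrderIdeal c w ρ := by
  refine Ideal.span_le.mpr ?_
  rintro _ ⟨e, he, rfl⟩
  exact cmonom_mem_weightedOrderIdeal c w (h.trans he)

/-- **`F_ρ · F_{ρ'} ⊆ F_{ρ+ρ'}`** (`v_L(fg) ≥ v_L(f) + v_L(g)`; the `F_ρ` form a multiplicative filtration).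
[cite: CossartJannsenSaito2020, Def. 7.2 (1)] -/
theorem weightedOrderIdeal_mul_le (c : σ → R) (w : σ → ℕ) (ρ ρ' : ℕ) :
    weightedOrderIdeal c w ρ * weightedOrderIdeal c w ρ' ≤ weightedOrderIdeal c w (ρ + ρ') := by
  rw [weightedOrderIdeal, weightedOrderIdeal, Ideal.span_mul_span']
  refine Ideal.span_le.mpr ?_
  rintro _ ⟨_, ⟨e, he, rfl⟩, _, ⟨e', he', rfl⟩, rfl⟩
  change cmonom c e * cmonom c e' ∈ _
  rw [← cmonom_add]
  refine cmonom_mem_weightedOrderIdeal c w ?_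
  rw [map_add]
  exact add_le_add he he'

/-- `F_ρ ^ n ⊆ F_{nρ}`. [cite: CossartJannsenSaito2020, Def. 7.2 (1)] -/
theorem weightedOrderIdeal_pow_le (c : σ → R) (w : σ → ℕ) (ρ : ℕ) :
    ∀ n : ℕ, weightedOrderIdeal c w ρ ^ n ≤ weightedOrderIdeal c w (n * ρ)
  | 0 => by rw [pow_zero, zero_mul, weightedOrderIdeal_zero, Ideal.one_eq_top]
  | n + 1 => by
    rw [pow_succ, add_mul, one_mul]
    exact (Ideal.mul_mono_left (weightedOrderIdeal_pow_le c w ρ n)).trans (weightedOrderIdeal_mul_le c w _ _)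

/-- `c_i ∈ F_{w_i}`. [cite: CossartJannsenSaito2020, Def. 7.2 (1)] -/
theorem apply_mem_weightedOrderIdeal (c : σ → R) (w : σ → ℕ) (i : σ) : c i ∈ weightedOrderIdeal c w (w i) := by
  rw [← cmonom_single c i]
  refine cmonom_mem_weightedOrderIdeal c w ?_
  rw [Finsupp.weight_apply, Finsupp.sum_single_index (by simp)]
  simp

/-- **`𝔪 ⊆ F_1`** when all weights are positive and `(c) = 𝔪`. [cite: CossartJannsenSaito2020, Def. 7.2 (1)] -/
theorem maximalIdeal_le_weightedOrderIdeal_one [IsLocalRing R] (c : σ → R) (w : σ → ℕ) (hw : ∀ i, 0 < w i)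
    (hgen : Ideal.span (Set.range c) = maximalIdeal R) : maximalIdeal R ≤ weightedOrderIdeal c w 1 := by
  rw [← hgen, Ideal.span_le]
  rintro _ ⟨i, rfl⟩
  exact weightedOrderIdeal_antitone c w (hw i) (apply_mem_weightedOrderIdeal c w i)

/-- **`𝔪 · F_ρ ⊆ F_{ρ+1}`** when all weights are positive and `(c) = 𝔪`. [cite: CossartJannsenSaito2020, Def. 7.2 (1)] -/
theorem maximalIdeal_mul_weightedOrderIdeal_le [IsLocalRing R] (c : σ → R) (w : σ → ℕ) (hw : ∀ i, 0 < w i)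
    (hgen : Ideal.span (Set.range c) = maximalIdeal R) (ρ : ℕ) :
    maximalIdeal R * weightedOrderIdeal c w ρ ≤ weightedOrderIdeal c w (ρ + 1) :=
  calc maximalIdeal R * weightedOrderIdeal c w ρ ≤ weightedOrderIdeal c w 1 * weightedOrderIdeal c w ρ :=
        Ideal.mul_mono_left (maximalIdeal_le_weightedOrderIdeal_one c w hw hgen)
    _ ≤ weightedOrderIdeal c w (1 + ρ) := weightedOrderIdeal_mul_le c w 1 ρ
    _ = weightedOrderIdeal c w (ρ + 1) := by rw [add_comm]

/-- **`𝔪^ρ ⊆ F_ρ`** when all weights are positive and `(c) = 𝔪` (`v_L(f) ≥ ord_𝔪(f)` for `L ≥ 𝟙`).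
[cite: CossartJannsenSaito2020, Def. 7.2 (1)] -/
theorem pow_maximalIdeal_le_weightedOrderIdeal [IsLocalRing R] (c : σ → R) (w : σ → ℕ) (hw : ∀ i, 0 < w i)
    (hgen : Ideal.span (Set.range c) = maximalIdeal R) (ρ : ℕ) : maximalIdeal R ^ ρ ≤ weightedOrderIdeal c w ρ :=
  calc maximalIdeal R ^ ρ ≤ weightedOrderIdeal c w 1 ^ ρ := Ideal.pow_right_mono (maximalIdeal_le_weightedOrderIdeal_one c w hw hgen) ρ
    _ ≤ weightedOrderIdeal c w (ρ * 1) := weightedOrderIdeal_pow_le c w 1 ρ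
    _ = weightedOrderIdeal c w ρ := by rw [mul_one]

/-- `c^e ∈ I^{|e|}` when all `c_i ∈ I` (`|e| = Σ e_i = Finsupp.degree e`). [cite: CossartJannsenSaito2020, (7.3)] -/
theorem cmonom_mem_pow_degree (c : σ → R) (I : Ideal R) (hc : ∀ i, c i ∈ I) (e : σ →₀ ℕ) :
    cmonom c e ∈ I ^ e.degree := by
  classical
  induction e using Finsupp.induction with
  | zero => rw [cmonom_zero, map_zero, pow_zero, Ideal.one_eq_top]; trivial
  | single_add i n f hi hn ih =>
    rw [cmonom_add, map_add, Finsupp.degree_single, pow_add, cmonom_single_pow]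
    exact Ideal.mul_mem_mul (Ideal.pow_mem_pow (hc i) n) ih

/-- `⟨w, e⟩ ≤ W · |e|` when every weight is `≤ W`. [cite: CossartJannsenSaito2020, Def. 7.2 (1)] -/
theorem weight_le_mul_degree (w : σ → ℕ) {W : ℕ} (hW : ∀ i, w i ≤ W) (e : σ →₀ ℕ) :
    Finsupp.weight w e ≤ W * e.degree := by
  classical
  induction e using Finsupp.induction with
  | zero => simp
  | single_add i n f hi hn ih =>
    rw [map_add, map_add, Finsupp.weight_single, Finsupp.degree_single, mul_add, smul_eq_mul]
    have h1 : n * w i ≤ W * n := by rw [mul_comm]; exact Nat.mul_le_mul_right n (hW i)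
    exact add_le_add h1 ih

/-- **`F^{(w)}_{W·ρ} ⊆ I^ρ` when every weight is `≤ W`, `W > 0`,** and all `c_i ∈ I` (a monomial of weight `≥ Wρ` has degree `≥ ρ`).
[cite: CossartJannsenSaito2020, Def. 7.2 (1)] -/
theorem weightedOrderIdeal_le_pow (c : σ → R) (w : σ → ℕ) {W : ℕ} (hW0 : 0 < W) (hW : ∀ i, w i ≤ W) (I : Ideal R)
    (hc : ∀ i, c i ∈ I) (ρ : ℕ) : weightedOrderIdeal c w (W * ρ) ≤ I ^ ρ := by
  refine Ideal.span_le.mpr ?_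
  rintro _ ⟨e, he, rfl⟩
  have hdeg : ρ ≤ e.degree := Nat.le_of_mul_le_mul_left (he.trans (weight_le_mul_degree w hW e)) hW0
  exact SetLike.le_def.mp (Ideal.pow_le_pow_right hdeg) (cmonom_mem_pow_degree c I hc e)

/-- **For the constant weight `w ≡ 1` and `(c) = 𝔪`: `F_ρ = 𝔪^ρ`** (`v_𝟙 = ord_𝔪`; CJS: `n_(u)` vs `v_𝔪`, Ch. 7).
[cite: CossartJannsenSaito2020, Def. 7.2 (1)] -/
theorem weightedOrderIdeal_one_eq_pow [IsLocalRing R] (c : σ → R) (hgen : Ideal.span (Set.range c) = maximalIdeal R) (ρ : ℕ) :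
    weightedOrderIdeal c (fun _ => 1) ρ = maximalIdeal R ^ ρ := by
  refine le_antisymm ?_ (pow_maximalIdeal_le_weightedOrderIdeal c _ (fun _ => Nat.one_pos) hgen ρ)
  have hc : ∀ i, c i ∈ maximalIdeal R := fun i => hgen ▸ Ideal.subset_span ⟨i, rfl⟩
  simpa using weightedOrderIdeal_le_pow c (fun _ => 1) (W := 1) Nat.one_pos (fun _ => le_rfl) (maximalIdeal R) hc ρ

/-- **`F_ρ = {P(c) : every monomial of P has weight ≥ ρ}`** — membership in a weighted order ideal means having SOME presentation by
monomials of weight `≥ ρ` (the expansion-free reading of `v_L(f) ≥ ρ`, Def. 7.2 (1) with (7.3)).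
[cite: CossartJannsenSaito2020, Def. 7.2 (1)] -/
theorem mem_weightedOrderIdeal_iff_exists_mvPolynomial (c : σ → R) (w : σ → ℕ) (ρ : ℕ) (f : R) :
    f ∈ weightedOrderIdeal c w ρ ↔
      ∃ P : MvPolynomial σ R, (∀ m ∈ P.support, ρ ≤ Finsupp.weight w m) ∧ eval c P = f := by
  classical
  constructor
  · intro hf
    refine Submodule.span_induction ?_ ?_ ?_ ?_ hf
    · rintro _ ⟨e, he, rfl⟩
      refine ⟨monomial e 1, ?_, ?_⟩
      · intro m hm
        have hm' := Finset.mem_singleton.mp (support_monomial_subset hm)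
        subst hm'; exact he
      · rw [eval_monomial_eq_cmonom, one_mul]
    · exact ⟨0, by simp, by simp⟩
    · rintro f g - - ⟨P, hP, rfl⟩ ⟨Q, hQ, rfl⟩
      refine ⟨P + Q, fun m hm => ?_, by rw [map_add]⟩
      rcases Finset.mem_union.mp (support_add hm) with h | h
      · exact hP m h
      · exact hQ m h
    · rintro r f - ⟨P, hP, rfl⟩
      refine ⟨C r * P, fun m hm => ?_, by rw [map_mul, eval_C, smul_eq_mul]⟩
      have : m ∈ P.support := by
        rw [mem_support_iff] at hm ⊢
        rw [coeff_C_mul] at hm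
        exact right_ne_zero_of_mul hm
      exact hP m this
  · rintro ⟨P, hP, rfl⟩
    rw [P.as_sum, map_sum]
    refine Ideal.sum_mem _ fun m hm => ?_
    rw [eval_monomial_eq_cmonom]
    exact Ideal.mul_mem_left _ _ (cmonom_mem_weightedOrderIdeal c w (hP m hm))

/-! ## Compatibility with the `Fin 3` development -/

/-- `monom3 = cmonom` on `Fin 3`. [cite: CossartJannsenSaito2020, (7.3)] -/
theorem monom3_eq_cmonom (c : Fin 3 → R) (e : Fin 3 →₀ ℕ) : monom3 c e = cmonom c e := by
  rw [cmonom_eq_prod, Fin.prod_univ_three, monom3]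

/-- **The tree's `weightedIdealW` (three parameters, arbitrary weights) is `weightedOrderIdeal` for `σ = Fin 3`.**
[cite: CossartJannsenSaito2020, Def. 7.2 (1)] -/
theorem weightedIdealW_eq_weightedOrderIdeal (c : Fin 3 → R) (w : Fin 3 → ℕ) (ρ : ℕ) :
    weightedIdealW c w ρ = weightedOrderIdeal c w ρ := by
  unfold weightedIdealW weightedOrderIdeal
  congr 1
  ext m
  simp only [Set.mem_setOf_eq, monom3_eq_cmonom]

end Literature.AlgebraicGeometry.Resolution

end
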